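import Summits.ValiantsHypothesis.ValiantsHypothesis.Theorems.GrenetZeonDualUnipotentThreeHalvesLongMassRankOneTriangular
import Summits.ValiantsHypothesis.ValiantsHypothesis.Theorems.GrenetZeonDualUnipotentThreeHalvesHeavyTopBand

/-!
# `GrenetZeon.DualUnipotentThreeHalves` (stmt-ValiantsHypothesis-24318), line `slow_core`, stub `stub_longMassSlowLawInv` ((c)):
# RANK-ONE-GENERATED **AFFINE** NILPOTENT PENCILS ARE (c)-CHEAP (`c = 3`)

Sequel of ✓ `…LongMassRankOneTriangular` (`relCert_of_rankOne_generated`, LINEAR pencils): the constant part may itself be an outer product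
`N(0) = u₀ w₀ᵀ`.  THEOREM ★★ `relCert_of_rankOne_generated_affine`: an affine pencil `N` over the `n²` coordinates with `N ^ H = 0`, constant part
`u₀ w₀ᵀ` and every coefficient matrix `[x_e] N = u_e w_eᵀ`, satisfies `RelCert n m N (3·(⌊√n⌋·m))` — (c)'s conclusion with `c = 3`, `n₀ = 0`.

Proof.  AUGMENT the coordinates by one slot (`Option (Fin n × Fin n)`, the slot `none` carrying `u₀ w₀ᵀ`): by HOMOGENISATION every combination
`s·u₀w₀ᵀ + Σ_e v_e·u_e w_eᵀ` is nilpotent of index `≤ H + m` (`s ≠ 0`: it is `s·N(s⁻¹v)`; `s = 0`: it is the linear part, ✓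
`RadicalSplit.linPart_pow_eq_zero`), so the augmented Gram matrix is hereditarily nilpotent (✓ `hereditarilyNilpotent_gram`), carries levels
(✓ `exists_levels_of_hereditarilyNilpotent`), and the flag/McCoy argument of the linear file — restated here for an ARBITRARY finite index type
`κ` (§1, membership-form generalisation of ✓ `…LongMassRankOneTriangular` §4; `exists_conj_upper_of_forall_pow_eq_zero`) — triangularises `{u₀w₀ᵀ} ∪ {u_e w_eᵀ}` by ONE invertible `S`; every value
`N(x) = u₀w₀ᵀ + Σ x_e u_e w_eᵀ` is then upper triangular and nilpotent after conjugation, hence strictly upper triangular, and ✓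
`TriangularRow.relCert_of_values_triangularisable` prices the pencil.

Honest framing: support row (`--supports stmt-ValiantsHypothesis-24318`); the locus is reducible (common kernel), so it never meets an
`IrreducibleInv` constituent of size `≥ 2`; NOT progress on (c) `SlowCore.LongMassSlowLawInv`, which with S3, 24318, 8062, VP ≠ VNP stays OPEN /
NOT proved.  No sorry, no definitions, no named facts. [folklore; McCoy via the tree]
-/

-- single-conjunct layout: Sub = Summit, duplicated namespace component intended (the name is mandated)
set_option linter.dupNamespace false
set_option autoImplicit false

noncomputable section

namespace Summit.ValiantsHypothesis.ValiantsHypothesis.Theorems.GrenetZeon.LongMassRankOne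

open MvPolynomial Matrix
open scoped BigOperators
open Summit.ValiantsHypothesis.ValiantsHypothesis.Cruxes.TwoDimCoefficients.DimTwoCases (AffMat IsAffine)
open Summit.ValiantsHypothesis.ValiantsHypothesis.Theorems.GrenetZeon.SlowCore (Ledger RelCert)
open Summit.ValiantsHypothesis.ValiantsHypothesis.Theorems.GrenetZeon.FlagCost (conj_pow_eq)
open Summit.ValiantsHypothesis.ValiantsHypothesis.Theorems.GrenetZeon.TriangularRow (relCert_of_values_triangularisable)
open Summit.ValiantsHypothesis.ValiantsHypothesis.Theorems.GrenetZeon.HeavyTopCodimOnePattern (diag_eq_zero_of_isNilpotent_triangular)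
open Summit.ValiantsHypothesis.ValiantsHypothesis.Theorems.GrenetZeon.RadicalSplit (linPart linPart_pow_eq_zero)

variable {m : ℕ}

/-! ## §1 The flag and McCoy's criterion over an arbitrary finite index type -/

section FlagGeneric

variable {κ : Type*}
variable (u w : κ → Fin m → ℂ) (ℓ : κ → ℕ) (L : ℕ)

/-- Monotonicity of the flag `F t = span{u_e : ℓ e < t}` (`= ⊤` past the top level `L`), membership form. -/
theorem mem_flagK_succ_of_mem (t : ℕ) {x : Fin m → ℂ}
    (hx : x ∈ Submodule.span ℂ {v : Fin m → ℂ | (∃ e, ℓ e < t ∧ v = u e) ∨ L < t}) :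
    x ∈ Submodule.span ℂ {v : Fin m → ℂ | (∃ e, ℓ e < t + 1 ∧ v = u e) ∨ L < t + 1} := by
  refine Submodule.span_mono ?_ hx
  rintro v (⟨e, he, rfl⟩ | hL)
  · exact Or.inl ⟨e, by omega, rfl⟩
  · exact Or.inr (by omega)

/-- The bottom of the flag is trivial, membership form. -/
theorem eq_zero_of_mem_flagK_zero {x : Fin m → ℂ}
    (hx : x ∈ Submodule.span ℂ {v : Fin m → ℂ | (∃ e, ℓ e < 0 ∧ v = u e) ∨ L < 0}) : x = 0 := by
  have h : Submodule.span ℂ {v : Fin m → ℂ | (∃ e, ℓ e < 0 ∧ v = u e) ∨ L < 0} = ⊥ := by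
    rw [Submodule.span_eq_bot]
    rintro v (⟨e, he, -⟩ | hL)
    · exact absurd he (Nat.not_lt_zero _)
    · exact absurd hL (Nat.not_lt_zero _)
  rw [h] at hx
  exact (Submodule.mem_bot ℂ).mp hx

/-- Everything lies in the top of the flag, membership form. -/
theorem mem_flagK_top (x : Fin m → ℂ) :
    x ∈ Submodule.span ℂ {v : Fin m → ℂ | (∃ e, ℓ e < L + 1 ∧ v = u e) ∨ L < L + 1} :=
  Submodule.subset_span (Or.inr (Nat.lt_succ_self L))

variable {u w ℓ L}

/-- The generators LOWER the flag. -/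
theorem vecMulVec_mulVec_mem_flagK (hℓ : ∀ e e', w e ⬝ᵥ u e' ≠ 0 → ℓ e < ℓ e') (hL : ∀ e, ℓ e < L)
    (e' : κ) (t : ℕ) (x : Fin m → ℂ)
    (hx : x ∈ Submodule.span ℂ {v : Fin m → ℂ | (∃ e, ℓ e < t + 1 ∧ v = u e) ∨ L < t + 1}) :
    vecMulVec (u e') (w e') *ᵥ x ∈ Submodule.span ℂ {v : Fin m → ℂ | (∃ e, ℓ e < t ∧ v = u e) ∨ L < t} := by
  induction hx using Submodule.span_induction with
  | mem v hv =>
    rw [vecMulVec_mulVec, op_smul_eq_smul]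
    rcases hv with ⟨e, he, rfl⟩ | hLt
    · by_cases hz : w e' ⬝ᵥ u e = 0
      · rw [hz, zero_smul]; exact Submodule.zero_mem _
      · have := hℓ e' e hz
        exact Submodule.smul_mem _ _ (Submodule.subset_span (Or.inl ⟨e', by omega, rfl⟩))
    · have := hL e'
      exact Submodule.smul_mem _ _ (Submodule.subset_span (Or.inl ⟨e', by omega, rfl⟩))
  | zero => rw [Matrix.mulVec_zero]; exact Submodule.zero_mem _
  | add x y _ _ hx hy => rw [Matrix.mulVec_add]; exact Submodule.add_mem _ hx hy
  | smul a x _ hx => rw [Matrix.mulVec_smul]; exact Submodule.smul_mem _ _ hx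

/-- The generators PRESERVE each `F t`. -/
theorem vecMulVec_mulVec_mem_flagK_self (hℓ : ∀ e e', w e ⬝ᵥ u e' ≠ 0 → ℓ e < ℓ e') (hL : ∀ e, ℓ e < L)
    (e' : κ) (t : ℕ) (x : Fin m → ℂ)
    (hx : x ∈ Submodule.span ℂ {v : Fin m → ℂ | (∃ e, ℓ e < t ∧ v = u e) ∨ L < t}) :
    vecMulVec (u e') (w e') *ᵥ x ∈ Submodule.span ℂ {v : Fin m → ℂ | (∃ e, ℓ e < t ∧ v = u e) ∨ L < t} := by
  cases t with
  | zero =>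
    rw [eq_zero_of_mem_flagK_zero u ℓ L hx, Matrix.mulVec_zero]
    exact Submodule.zero_mem _
  | succ t => exact mem_flagK_succ_of_mem u ℓ L t (vecMulVec_mulVec_mem_flagK hℓ hL e' t x hx)

/-- Noncommutative polynomials in the generators PRESERVE each `F t`. -/
theorem lift_mulVec_mem_flagK (hℓ : ∀ e e', w e ⬝ᵥ u e' ≠ 0 → ℓ e < ℓ e') (hL : ∀ e, ℓ e < L)
    (p : FreeAlgebra ℂ κ) (t : ℕ) (x : Fin m → ℂ)
    (hx : x ∈ Submodule.span ℂ {v : Fin m → ℂ | (∃ e, ℓ e < t ∧ v = u e) ∨ L < t}) :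
    (FreeAlgebra.lift ℂ (fun e => vecMulVec (u e) (w e)) p) *ᵥ x ∈
      Submodule.span ℂ {v : Fin m → ℂ | (∃ e, ℓ e < t ∧ v = u e) ∨ L < t} := by
  induction p using FreeAlgebra.induction generalizing x with
  | grade0 r =>
    rw [AlgHom.commutes, Algebra.algebraMap_eq_smul_one, Matrix.smul_mulVec, Matrix.one_mulVec]
    exact Submodule.smul_mem _ _ hx
  | grade1 e => rw [FreeAlgebra.lift_ι_apply]; exact vecMulVec_mulVec_mem_flagK_self hℓ hL e t x hx
  | mul a b ha hb => rw [map_mul, ← Matrix.mulVec_mulVec]; exact ha _ (hb _ hx)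
  | add a b ha hb => rw [map_add, Matrix.add_mulVec]; exact Submodule.add_mem _ (ha _ hx) (hb _ hx)

/-- McCoy's hypothesis: every `p(V)·(V_k V_l − V_l V_k)` lowers the flag, hence is nilpotent. -/
theorem isNilpotent_lift_mul_commutatorK (hℓ : ∀ e e', w e ⬝ᵥ u e' ≠ 0 → ℓ e < ℓ e') (hL : ∀ e, ℓ e < L)
    (p : FreeAlgebra ℂ κ) (k l : κ) :
    IsNilpotent (FreeAlgebra.lift ℂ (fun e => vecMulVec (u e) (w e)) p *
      (vecMulVec (u k) (w k) * vecMulVec (u l) (w l) - vecMulVec (u l) (w l) * vecMulVec (u k) (w k))) := by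
  set X := FreeAlgebra.lift ℂ (fun e => vecMulVec (u e) (w e)) p *
      (vecMulVec (u k) (w k) * vecMulVec (u l) (w l) - vecMulVec (u l) (w l) * vecMulVec (u k) (w k)) with hX
  have hdrop : ∀ t x, x ∈ Submodule.span ℂ {v : Fin m → ℂ | (∃ e, ℓ e < t + 1 ∧ v = u e) ∨ L < t + 1} →
      X *ᵥ x ∈ Submodule.span ℂ {v : Fin m → ℂ | (∃ e, ℓ e < t ∧ v = u e) ∨ L < t} := by
    intro t x hx
    rw [hX, ← Matrix.mulVec_mulVec, Matrix.sub_mulVec, ← Matrix.mulVec_mulVec, ← Matrix.mulVec_mulVec]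
    refine lift_mulVec_mem_flagK hℓ hL p t _ (Submodule.sub_mem _ ?_ ?_)
    · exact vecMulVec_mulVec_mem_flagK_self hℓ hL k t _ (vecMulVec_mulVec_mem_flagK hℓ hL l t x hx)
    · exact vecMulVec_mulVec_mem_flagK_self hℓ hL l t _ (vecMulVec_mulVec_mem_flagK hℓ hL k t x hx)
  have hpow : ∀ j t x, x ∈ Submodule.span ℂ {v : Fin m → ℂ | (∃ e, ℓ e < t + j ∧ v = u e) ∨ L < t + j} →
      (X ^ j) *ᵥ x ∈ Submodule.span ℂ {v : Fin m → ℂ | (∃ e, ℓ e < t ∧ v = u e) ∨ L < t} := by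
    intro j
    induction j with
    | zero => intro t x hx; rw [pow_zero, Matrix.one_mulVec]; simpa using hx
    | succ j ih =>
      intro t x hx
      rw [pow_succ, ← Matrix.mulVec_mulVec]
      exact ih t _ (hdrop (t + j) x (by rw [show t + j + 1 = t + (j + 1) by ring]; exact hx))
  refine ⟨L + 1, ?_⟩
  ext i j
  have hcol : (X ^ (L + 1)) *ᵥ (Pi.single j 1) = 0 := by
    have h := hpow (L + 1) 0 (Pi.single j 1) (by rw [zero_add]; exact mem_flagK_top u ℓ L _)
    exact eq_zero_of_mem_flagK_zero u ℓ L h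
  have := congrFun hcol i
  rw [Matrix.mulVec_single_one] at this
  exact this

/-- ★ ONE invertible `S` makes every generator of a rank-one family whose Gram matrix carries levels UPPER TRIANGULAR (entries below the
diagonal vanish; McCoy, ✓ Literature `forall_isNilpotent_iff_exists_isUnit`; arbitrary finite index type). -/
theorem exists_conj_upper_of_levels (hℓ : ∀ e e', w e ⬝ᵥ u e' ≠ 0 → ℓ e < ℓ e') (hL : ∀ e, ℓ e < L) :
    ∃ S : Matrix (Fin m) (Fin m) ℂ, IsUnit S ∧ ∀ e (a b : Fin m), b < a → (S⁻¹ * vecMulVec (u e) (w e) * S) a b = 0 := by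
  obtain ⟨S, hS, h⟩ :=
    (Literature.LinearAlgebra.Matrix.SimultaneousTriangularization.forall_isNilpotent_iff_exists_isUnit
      (fun e => vecMulVec (u e) (w e))).mp (fun p k l => isNilpotent_lift_mul_commutatorK hℓ hL p k l)
  exact ⟨S, hS, fun e a b hab => h e hab⟩

/-- `Σ_e x_e • u_e w_eᵀ = U · diagonal x · Wᵀ` (arbitrary index type). -/
theorem sum_smul_vecMulVec_eq_mulK [Fintype κ] [DecidableEq κ] (u w : κ → Fin m → ℂ) (x : κ → ℂ) :
    (∑ e, x e • vecMulVec (u e) (w e)) = (Matrix.of fun i e => u e i) * Matrix.diagonal x * (Matrix.of fun e j => w e j) := by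
  ext i j
  rw [Matrix.sum_apply, Matrix.mul_apply]
  refine Finset.sum_congr rfl fun e _ => ?_
  rw [Matrix.mul_diagonal, Matrix.smul_apply, vecMulVec_apply, Matrix.of_apply, Matrix.of_apply, smul_eq_mul]
  ring

/-- ★ **From uniform nilpotency of all combinations to ONE triangularising basis.**  If every combination `Σ_e x_e • u_e w_eᵀ` satisfies
`(·)^{h+1} = 0`, one invertible `S` makes every `S⁻¹ (u_e w_eᵀ) S` upper triangular. -/
theorem exists_conj_upper_of_forall_pow_eq_zero [Fintype κ] [DecidableEq κ] (u w : κ → Fin m → ℂ) {h : ℕ}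
    (hnil : ∀ x : κ → ℂ, (∑ e, x e • vecMulVec (u e) (w e)) ^ (h + 1) = 0) :
    ∃ S : Matrix (Fin m) (Fin m) ℂ, IsUnit S ∧ ∀ e (a b : Fin m), b < a → (S⁻¹ * vecMulVec (u e) (w e) * S) a b = 0 := by
  classical
  have hval : ∀ x : κ → ℂ, ((Matrix.of fun i e => u e i) * Matrix.diagonal x * (Matrix.of fun e j => w e j)) ^ (h + 1) = 0 :=
    fun x => by rw [← sum_smul_vecMulVec_eq_mulK]; exact hnil x
  have hgram : (Matrix.of fun e e' => w e ⬝ᵥ u e') = (Matrix.of fun e j => w e j) * (Matrix.of fun i e => u e i) := by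
    ext e e'; rw [Matrix.of_apply, Matrix.mul_apply]; rfl
  obtain ⟨ℓ, hℓ⟩ := exists_levels_of_hereditarilyNilpotent (Matrix.of fun e e' => w e ⬝ᵥ u e') fun k c hc => by
    rw [hgram]; exact hereditarilyNilpotent_gram _ _ hval k c hc
  set L : ℕ := Finset.univ.sup ℓ + 1 with hLdef
  have hL : ∀ e, ℓ e < L := fun e => Nat.lt_succ_of_le (Finset.le_sup (f := ℓ) (Finset.mem_univ e))
  exact exists_conj_upper_of_levels (fun e e' h => hℓ e e' h) hL

end FlagGeneric

/-! ## §2 ★★ The affine row -/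

variable {n : ℕ}

/-- The values of an affine pencil with outer-product constant part and coefficients: `N(x) = u₀w₀ᵀ + Σ_e x_e • u_e w_eᵀ`. -/
theorem map_eval_eq_affine_vecMulVec (N : AffMat n m) (hN : IsAffine N) (u₀ w₀ : Fin m → ℂ)
    (h0 : ∀ i j, coeff 0 (N i j) = u₀ i * w₀ j) (u w : Fin n × Fin n → Fin m → ℂ)
    (hcoef : ∀ e i j, coeff (Finsupp.single e 1) (N i j) = u e i * w e j) (x : Fin n × Fin n → ℂ) :
    N.map (eval x) = vecMulVec u₀ w₀ + ∑ e, x e • vecMulVec (u e) (w e) := by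
  ext i j
  rw [Matrix.map_apply, Matrix.add_apply, Matrix.sum_apply, vecMulVec_apply]
  have haff := Literature.Computability.AlgebraicComplexity.LRPencil.eq_affine_of_totalDegree_le_one (N i j) (hN i j)
  conv_lhs => rw [haff]
  simp only [map_add, map_sum, map_mul, eval_C, eval_X, h0 i j, Matrix.smul_apply, vecMulVec_apply, smul_eq_mul, hcoef]
  congr 1
  exact Finset.sum_congr rfl fun e _ => by ring

/-- The AUGMENTED combination: slot `none` carries the constant part. -/
theorem sum_option_smul_vecMulVec (u₀ w₀ : Fin m → ℂ) (u w : Fin n × Fin n → Fin m → ℂ) (y : Option (Fin n × Fin n) → ℂ) :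
    (∑ o : Option (Fin n × Fin n), y o • vecMulVec ((o.elim u₀ u)) ((o.elim w₀ w))) =
      y none • vecMulVec u₀ w₀ + ∑ e, y (some e) • vecMulVec (u e) (w e) := by
  rw [Fintype.sum_option]
  rfl

/-- **HOMOGENISATION**: every augmented combination `s·u₀w₀ᵀ + Σ v_e u_e w_eᵀ` is nilpotent of index `≤ H + m`. -/
theorem pow_augmented_eq_zero (N : AffMat n m) (hN : IsAffine N) {H : ℕ} (hnil : N ^ H = 0) (u₀ w₀ : Fin m → ℂ)
    (h0 : ∀ i j, coeff 0 (N i j) = u₀ i * w₀ j) (u w : Fin n × Fin n → Fin m → ℂ)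
    (hcoef : ∀ e i j, coeff (Finsupp.single e 1) (N i j) = u e i * w e j) (y : Option (Fin n × Fin n) → ℂ) :
    (∑ o : Option (Fin n × Fin n), y o • vecMulVec ((o.elim u₀ u)) ((o.elim w₀ w))) ^ (H + m) = 0 := by
  rw [sum_option_smul_vecMulVec]
  by_cases hs : y none = 0
  · -- the linear part
    have hm : N ^ m = 0 :=
      Summit.ValiantsHypothesis.ValiantsHypothesis.Theorems.GrenetZeon.SlowCore.pow_card_eq_zero_of_pow_eq_zero N hnil
    have hlin : (∑ e, y (some e) • vecMulVec (u e) (w e)) = linPart N (fun e => y (some e)) := by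
      unfold linPart
      rw [map_eval_eq_affine_vecMulVec N hN u₀ w₀ h0 u w hcoef, map_eval_eq_affine_vecMulVec N hN u₀ w₀ h0 u w hcoef]
      simp
    rw [hs, zero_smul, zero_add, hlin, pow_add, pow_mul_comm, linPart_pow_eq_zero N hN hm, Matrix.zero_mul]
  · -- a scaled value
    have hscale : y none • vecMulVec u₀ w₀ + ∑ e, y (some e) • vecMulVec (u e) (w e) =
        y none • N.map (eval fun e => (y none)⁻¹ * y (some e)) := by
      rw [map_eval_eq_affine_vecMulVec N hN u₀ w₀ h0 u w hcoef, smul_add, Finset.smul_sum]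
      congr 1
      refine Finset.sum_congr rfl fun e _ => ?_
      rw [smul_smul, mul_inv_cancel_left₀ hs]
    rw [hscale, smul_pow, ← Matrix.map_pow, pow_add N H m, hnil, Matrix.zero_mul, Matrix.map_zero _ (map_zero _), smul_zero]

/-- ★★ **RANK-ONE-GENERATED AFFINE NILPOTENT PENCILS ARE (c)-CHEAP (`c = 3`).**  An affine pencil over the `n²` coordinates with
`N ^ H = 0`, constant part an outer product `u₀ w₀ᵀ` and every coefficient matrix an outer product `u_e w_eᵀ`, has a whole-pencil
certificate of price `≤ 3·(⌊√n⌋·m)`. [this file] -/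
theorem relCert_of_rankOne_generated_affine (N : AffMat n m) (hN : IsAffine N) {H : ℕ} (hnil : N ^ H = 0)
    (u₀ w₀ : Fin m → ℂ) (h0 : ∀ i j, coeff 0 (N i j) = u₀ i * w₀ j) (u w : Fin n × Fin n → Fin m → ℂ)
    (hcoef : ∀ e i j, coeff (Finsupp.single e 1) (N i j) = u e i * w e j) :
    RelCert n m N (3 * (Nat.sqrt n * m)) := by
  classical
  have hHm : ∀ y : Option (Fin n × Fin n) → ℂ,
      (∑ o : Option (Fin n × Fin n), y o • vecMulVec ((o.elim u₀ u)) ((o.elim w₀ w))) ^ (H + m + 1) = 0 := fun y => by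
    rw [pow_succ, pow_augmented_eq_zero N hN hnil u₀ w₀ h0 u w hcoef y, Matrix.zero_mul]
  obtain ⟨S, hS, htri⟩ := exists_conj_upper_of_forall_pow_eq_zero (fun o : Option (Fin n × Fin n) => o.elim u₀ u)
    (fun o => o.elim w₀ w) hHm
  obtain ⟨uS, huS⟩ := hS
  refine relCert_of_values_triangularisable N hN (Set.range fun x : Fin n × Fin n → ℂ => N.map (eval x))
    (fun x => ⟨x, rfl⟩) uS⁻¹ ?_
  rintro A ⟨x, rfl⟩ i j hji
  have hP : ((uS⁻¹ : (Matrix (Fin m) (Fin m) ℂ)ˣ) : Matrix (Fin m) (Fin m) ℂ) = S⁻¹ := by rw [Matrix.coe_units_inv, huS]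
  have hP' : ((uS⁻¹⁻¹ : (Matrix (Fin m) (Fin m) ℂ)ˣ) : Matrix (Fin m) (Fin m) ℂ) = S := by rw [inv_inv, huS]
  rw [hP, hP']
  have hval : S⁻¹ * N.map (eval x) * S =
      S⁻¹ * vecMulVec u₀ w₀ * S + ∑ e, x e • (S⁻¹ * vecMulVec (u e) (w e) * S) := by
    rw [map_eval_eq_affine_vecMulVec N hN u₀ w₀ h0 u w hcoef x, Matrix.mul_add, Matrix.add_mul, Finset.mul_sum, Finset.sum_mul]
    congr 1
    refine Finset.sum_congr rfl fun e _ => ?_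
    rw [Matrix.mul_smul, Matrix.smul_mul]
  have hupper : ∀ a b : Fin m, b < a → (S⁻¹ * N.map (eval x) * S) a b = 0 := by
    intro a b hab
    have hnone : (S⁻¹ * vecMulVec u₀ w₀ * S) a b = 0 := htri none a b hab
    have hsome : ∀ e, (S⁻¹ * vecMulVec (u e) (w e) * S) a b = 0 := fun e => htri (some e) a b hab
    rw [hval, Matrix.add_apply, Matrix.sum_apply, hnone, zero_add]
    refine Finset.sum_eq_zero fun e _ => ?_
    rw [Matrix.smul_apply, hsome e, smul_zero]
  rcases lt_or_eq_of_le hji with hlt | heq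
  · exact hupper i j hlt
  · subst heq
    have hSinv : S⁻¹ * S = 1 := by rw [← huS, ← Matrix.coe_units_inv, ← Units.val_mul, inv_mul_cancel, Units.val_one]
    have hSinv' : S * S⁻¹ = 1 := by rw [← huS, ← Matrix.coe_units_inv, ← Units.val_mul, mul_inv_cancel, Units.val_one]
    have hnilx : IsNilpotent (S⁻¹ * N.map (eval x) * S) := by
      refine ⟨H, ?_⟩
      have h1 := conj_pow_eq S⁻¹ S (N.map (eval x)) hSinv' H
      rw [← Matrix.map_pow, hnil, Matrix.map_zero _ (map_zero _)] at h1
      have h3 : (S⁻¹ * N.map (eval x) * S) ^ H = (S⁻¹ * S) * (S⁻¹ * N.map (eval x) * S) ^ H * (S⁻¹ * S) := by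
        rw [hSinv, Matrix.one_mul, Matrix.mul_one]
      rw [h3, show (S⁻¹ * S) * (S⁻¹ * N.map (eval x) * S) ^ H * (S⁻¹ * S) =
        S⁻¹ * (S * (S⁻¹ * N.map (eval x) * S) ^ H * S⁻¹) * S by simp only [Matrix.mul_assoc], h1,
        Matrix.mul_zero, Matrix.zero_mul]
    refine diag_eq_zero_of_isNilpotent_triangular (fun a : Fin m => m - (a : ℕ)) (fun a b hab => Fin.ext (by
      have := a.is_lt; have := b.is_lt; beta_reduce at hab; omega)) _ (fun a b hab => hupper a b ?_) hnilx j
    have := a.is_lt; have := b.is_lt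
    beta_reduce at hab
    exact Fin.lt_def.mpr (by omega)

/-- ★ In the binder shape of (c) / `LongMassSlowLawAll`. [this file] -/
theorem longMass_on_rankOne_generated_affine_locus :
    ∀ (n b : ℕ) (B : AffMat n b), IsAffine B → B ^ b = 0 →
      (∃ u₀ w₀ : Fin b → ℂ, ∀ i j, coeff 0 (B i j) = u₀ i * w₀ j) →
      (∃ u w : Fin n × Fin n → Fin b → ℂ, ∀ e i j, coeff (Finsupp.single e 1) (B i j) = u e i * w e j) →
      RelCert n b B (3 * (Nat.sqrt n * b)) := by
  intro n b B hB hnil ⟨u₀, w₀, h0⟩ ⟨u, w, hcoef⟩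
  exact relCert_of_rankOne_generated_affine B hB hnil u₀ w₀ h0 u w hcoef

end Summit.ValiantsHypothesis.ValiantsHypothesis.Theorems.GrenetZeon.LongMassRankOne

end
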